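import Mathlib
import HarnessLib
import Summits.KontsevichZagierPeriods.KontsevichZagierPeriods.Theses.LinRedNormalForm
import Summits.KontsevichZagierPeriods.KontsevichZagierPeriods.Theorems.LinRedNormalFormDihedralNormalFormStubNestedReductionAux6
import Summits.KontsevichZagierPeriods.KontsevichZagierPeriods.Theorems.FurushoPentagonHoffmanRelationInKZDescents
import Summits.KontsevichZagierPeriods.KontsevichZagierPeriods.Theorems.FurushoPentagonHoffmanRelationInKZShuffleCells
import Literature.NumberTheory.Transcendental.KZLogCalculusProofs

/-!
# `DihedralNormalForm`: Newton–Leibniz along a SIMPLICIAL axis (translation move, vertex splitting)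

Support file (crux idea `vertex-splitting-unfolded-hyperlog`, stub `stub_translationNL` of its
sketch) for the crux `DihedralNormalForm` (stmt-KontsevichZagierPeriods-3912, route
`LinRedNormalForm`).  **Rule 3 along the axis `p` of the open ordered simplex**
`Δᵏ⁺¹ = {1 > t₀ > ⋯ > t_k > 0}`: the fibre of the coordinate `t_p` over the point
`y ∈ Δᵏ` (the other coordinates) is the interval between its two neighbours,
`loEdge p y = y_p` (the entry after the slot, or `0` if `p` is the last slot) and
`hiEdge p y = y_{p-1}` (the entry before the slot, or `1` if `p = 0`).  If `R = [Δᵏ⁺¹, W]` and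
`rb = [Δᵏ, F(insertNth p (hiEdge p ·) ·) − F(insertNth p (loEdge p ·) ·)]` are representations,
`F`, `W` are `ℚ`-semialgebraic on the closed axis band, and on every fibre `t ↦ F (insertNth p t y)`
is continuous on `[loEdge p y, hiEdge p y]` with derivative `W (insertNth p t y)` on the open
fibre, then `[R] − [rb] ∈ KZ.relations`.  This is the translation move of the vertex-splitting
relation family (the primitive `F` is RATIONAL and need not be integrable itself; only the band
integrand `W = ∂_p F` and the face difference are): summing it over a translation-invariant set of
axes of a form on `Δᵏ⁺¹` whose partial derivatives cancel gives a relation among representations on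
`Δᵏ` of the same dimension.  Proof: relabel `p ↦ last` (`Nested.reix`, one change of variables),
close the open band by the two null graphs `t = loEdge`, `t = hiEdge`, one Newton–Leibniz move
(`FurushoPentagon.HoffmanRelationInKZ.descents_closeBand`).

References: M. Kontsevich, D. Zagier, *Periods* (2001), §1.2, rules (2), (3); F. Brown,
*Multiple zeta values and periods of moduli spaces* (2009), §8 (Stokes on the cell).
-/

noncomputable section

open MeasureTheory Set

namespace Summit.KontsevichZagierPeriods.DihedralNormalForm.VertexSplitting

open Literature.NumberTheory.Transcendental
open Literature.ModelTheory.ExponentialFields (IsSemialgebraic)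
open Summit.KontsevichZagierPeriods.DihedralNormalForm.TorusDescent
open Summit.KontsevichZagierPeriods.DihedralNormalForm.TorusDescent.Nested
open Summit.KontsevichZagierPeriods.FurushoPentagon.HoffmanRelationInKZ

variable {k : ℕ}

/-! ## The fibre of an axis of the ordered simplex -/

/-- The upper edge of the fibre of slot `p`: the entry before the slot (larger), or `1` when `p = 0`. -/
def hiEdge (p : Fin (k + 1)) (y : Fin k → ℝ) : ℝ :=
  if h : 0 < (p : ℕ) then y ⟨(p : ℕ) - 1, by omega⟩ else 1

/-- The lower edge of the fibre of slot `p`: the entry after the slot (smaller), or `0` when `p` is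
the last slot. -/
def loEdge (p : Fin (k + 1)) (y : Fin k → ℝ) : ℝ :=
  if h : (p : ℕ) < k then y ⟨p, h⟩ else 0

/-- The upper edge is `ℚ`-semialgebraic (a coordinate or the constant `1`). [folklore] -/
theorem isSemialgebraicFunOn_hiEdge {S : Set (Fin k → ℝ)} (hS : IsSemialgebraic ℚ S)
    (p : Fin (k + 1)) : IsSemialgebraicFunOn ℚ S (hiEdge p) := by
  by_cases h : 0 < (p : ℕ)
  · have : hiEdge (k := k) p = fun y => y ⟨(p : ℕ) - 1, by omega⟩ := by
      funext y; simp [hiEdge, h]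
    rw [this]
    exact isSemialgebraicFunOn_apply hS _
  · have : hiEdge (k := k) p = fun _ => ((1 : ℚ) : ℝ) := by
      funext y; simp [hiEdge, h]
    rw [this]
    exact isSemialgebraicFunOn_const_ratCast hS 1

/-- The lower edge is `ℚ`-semialgebraic (a coordinate or the constant `0`). [folklore] -/
theorem isSemialgebraicFunOn_loEdge {S : Set (Fin k → ℝ)} (hS : IsSemialgebraic ℚ S)
    (p : Fin (k + 1)) : IsSemialgebraicFunOn ℚ S (loEdge p) := by
  by_cases h : (p : ℕ) < k
  · have : loEdge (k := k) p = fun y => y ⟨p, h⟩ := by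
      funext y; simp [loEdge, h]
    rw [this]
    exact isSemialgebraicFunOn_apply hS _
  · have : loEdge (k := k) p = fun _ => ((0 : ℚ) : ℝ) := by
      funext y; simp [loEdge, h]
    rw [this]
    exact isSemialgebraicFunOn_const_ratCast hS 0

/-- On the ordered simplex the fibre is non-degenerate: `loEdge < hiEdge`. [folklore] -/
theorem loEdge_lt_hiEdge (p : Fin (k + 1)) {y : Fin k → ℝ} (hy : y ∈ KZ.openOrderedSimplex k) :
    loEdge p y < hiEdge p y := by
  obtain ⟨h0, h1, hanti⟩ := hy
  by_cases hl : (p : ℕ) < k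
  · have hlo : loEdge p y = y ⟨p, hl⟩ := by simp [loEdge, hl]
    rw [hlo]
    by_cases hh : 0 < (p : ℕ)
    · have hhi : hiEdge p y = y ⟨(p : ℕ) - 1, by omega⟩ := by simp [hiEdge, hh]
      rw [hhi]
      exact hanti (Fin.mk_lt_mk.2 (by omega))
    · have hhi : hiEdge p y = 1 := by simp [hiEdge, hh]
      rw [hhi]
      exact h1 _
  · have hlo : loEdge p y = 0 := by simp [loEdge, hl]
    rw [hlo]
    by_cases hh : 0 < (p : ℕ)
    · have hhi : hiEdge p y = y ⟨(p : ℕ) - 1, by omega⟩ := by simp [hiEdge, hh]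
      rw [hhi]
      exact h0 _
    · have hhi : hiEdge p y = 1 := by simp [hiEdge, hh]
      rw [hhi]
      exact zero_lt_one

/-- **Fibre description.** For `y` in the ordered `k`-simplex, `insertNth p u y` lies in the ordered
`(k+1)`-simplex iff `loEdge p y < u < hiEdge p y`. [folklore] -/
theorem insertNth_mem_iff_edges (p : Fin (k + 1)) {y : Fin k → ℝ} (hy : y ∈ KZ.openOrderedSimplex k)
    (u : ℝ) : (Fin.insertNth p u y : Fin (k + 1) → ℝ) ∈ KZ.openOrderedSimplex (k + 1) ↔
      loEdge p y < u ∧ u < hiEdge p y := by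
  have hy' := hy
  obtain ⟨h0, h1, hanti⟩ := hy'
  rw [insertNth_mem_openOrderedSimplex_iff]
  constructor
  · rintro ⟨-, hu0, hu1, ha, hb⟩
    constructor
    · by_cases hl : (p : ℕ) < k
      · have hlo : loEdge p y = y ⟨p, hl⟩ := by simp [loEdge, hl]
        rw [hlo]
        exact hb ⟨p, hl⟩ (Fin.le_def.2 (by simp))
      · have hlo : loEdge p y = 0 := by simp [loEdge, hl]
        rw [hlo]
        exact hu0
    · by_cases hh : 0 < (p : ℕ)
      · have hhi : hiEdge p y = y ⟨(p : ℕ) - 1, by omega⟩ := by simp [hiEdge, hh]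
        rw [hhi]
        exact ha ⟨(p : ℕ) - 1, by omega⟩
          (by rw [Fin.lt_def, Fin.val_castSucc]; exact Nat.sub_lt hh Nat.one_pos)
      · have hhi : hiEdge p y = 1 := by simp [hiEdge, hh]
        rw [hhi]
        exact hu1
  · rintro ⟨hlo, hhi⟩
    have hlo0 : 0 ≤ loEdge p y := by
      by_cases hl : (p : ℕ) < k
      · have hlo' : loEdge p y = y ⟨p, hl⟩ := by simp [loEdge, hl]
        rw [hlo']; exact (h0 _).le
      · have hlo' : loEdge p y = 0 := by simp [loEdge, hl]
        rw [hlo']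
    have hhi1 : hiEdge p y ≤ 1 := by
      by_cases hh : 0 < (p : ℕ)
      · have hhi' : hiEdge p y = y ⟨(p : ℕ) - 1, by omega⟩ := by simp [hiEdge, hh]
        rw [hhi']; exact (h1 _).le
      · have hhi' : hiEdge p y = 1 := by simp [hiEdge, hh]
        rw [hhi']
    refine ⟨hy, hlo0.trans_lt hlo, hhi.trans_le hhi1, fun a ha => ?_, fun b hb => ?_⟩
    · have ha' : (a : ℕ) < (p : ℕ) := by simpa [Fin.lt_def] using ha
      have hh : 0 < (p : ℕ) := by omega
      have hhi' : hiEdge p y = y ⟨(p : ℕ) - 1, by omega⟩ := by simp [hiEdge, hh]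
      have hle : y ⟨(p : ℕ) - 1, by omega⟩ ≤ y a :=
        hanti.antitone (Fin.le_def.2 (by show (a : ℕ) ≤ (p : ℕ) - 1; omega))
      exact hhi.trans_le (hhi' ▸ hle)
    · have hb' : (p : ℕ) ≤ (b : ℕ) := by simpa [Fin.le_def] using hb
      have hl : (p : ℕ) < k := by omega
      have hlo' : loEdge p y = y ⟨p, hl⟩ := by simp [loEdge, hl]
      have hle : y b ≤ y ⟨p, hl⟩ := hanti.antitone (Fin.le_def.2 (by simpa using hb'))
      exact hle.trans_lt (hlo' ▸ hlo)

/-- The closed axis band of slot `p`: the other coordinates in the ordered `k`-simplex, the axis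
coordinate between its two neighbours (closed). -/
def sband (p : Fin (k + 1)) : Set (Fin (k + 1) → ℝ) :=
  {z | (fun j => z (p.succAbove j)) ∈ KZ.openOrderedSimplex k ∧
    loEdge p (fun j => z (p.succAbove j)) ≤ z p ∧ z p ≤ hiEdge p (fun j => z (p.succAbove j))}

/-- Reading through `reix p` turns the closed band over the ordered simplex (last coordinate between
the edges) into the axis band. [folklore] -/
theorem comp_reix_mem_sband_iff (p : Fin (k + 1)) (w : Fin (k + 1) → ℝ) :
    (fun i => w (reix p i)) ∈ sband p ↔
      w ∈ KZlog.band (KZ.openOrderedSimplex k) (loEdge p) (hiEdge p) := by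
  rw [comp_reix_eq_insertNth, KZlog.mem_band, sband, mem_setOf_eq]
  simp only [Fin.insertNth_apply_succAbove, Fin.insertNth_apply_same]

/-- Reading through `reix p`, the ordered `(k+1)`-simplex becomes the OPEN band over the ordered
`k`-simplex. [folklore] -/
theorem comp_reix_mem_openOrderedSimplex_iff (p : Fin (k + 1)) (w : Fin (k + 1) → ℝ) :
    (fun i => w (reix p i)) ∈ KZ.openOrderedSimplex (k + 1) ↔
      (Fin.init w : Fin k → ℝ) ∈ KZ.openOrderedSimplex k ∧ loEdge p (Fin.init w) < w (Fin.last k) ∧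
        w (Fin.last k) < hiEdge p (Fin.init w) := by
  rw [comp_reix_eq_insertNth]
  constructor
  · intro h
    have hy : (Fin.init w : Fin k → ℝ) ∈ KZ.openOrderedSimplex k :=
      (insertNth_mem_openOrderedSimplex_iff.1 h).1
    exact ⟨hy, (insertNth_mem_iff_edges p hy _).1 h⟩
  · rintro ⟨hy, hlo, hhi⟩
    exact (insertNth_mem_iff_edges p hy _).2 ⟨hlo, hhi⟩

/-- The axis band is `ℚ`-semialgebraic (preimage of a band under a coordinate permutation). [folklore] -/
theorem isSemialgebraic_sband (p : Fin (k + 1)) : IsSemialgebraic ℚ (sband (k := k) p) := by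
  have hS := KZ.isSemialgebraic_openOrderedSimplex k
  have hb : IsSemialgebraic ℚ (KZlog.band (KZ.openOrderedSimplex k) (loEdge p) (hiEdge p)) :=
    KZlog.isSemialgebraic_band (isSemialgebraicFunOn_loEdge hS p) (isSemialgebraicFunOn_hiEdge hS p)
  have h := hb.preimage_comp (reix p).symm
  convert h using 1
  ext z
  rw [mem_preimage, ← comp_reix_mem_sband_iff p]
  simp [Function.comp]

/-! ## The move -/

/-- **Rule 3 along the axis `p` of the open ordered simplex** (translation move).  If
`R = [Δᵏ⁺¹, W]` and `rb = [Δᵏ, F(insertNth p (hiEdge p y) y) − F(insertNth p (loEdge p y) y)]` are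
representations, `F`, `W` are `ℚ`-semialgebraic on the axis band, and on every fibre over the
ordered `k`-simplex `t ↦ F (insertNth p t y)` is continuous on `[loEdge p y, hiEdge p y]` with
derivative `W (insertNth p t y)` on the open fibre, then `[R] − [rb] ∈ KZ.relations`.
[cite: KontsevichZagier2001, §1.2 rule (3)] -/
theorem nl_axis_osimplex (p : Fin (k + 1)) (R : KZ.IntegralRep (k + 1)) (rb : KZ.IntegralRep k)
    (F W : (Fin (k + 1) → ℝ) → ℝ) (hRdom : R.domain = KZ.openOrderedSimplex (k + 1))
    (hRW : EqOn R.integrand W R.domain) (hbdom : rb.domain = KZ.openOrderedSimplex k)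
    (hW : IsSemialgebraicFunOn ℚ (sband p) W) (hF : IsSemialgebraicFunOn ℚ (sband p) F)
    (hcont : ∀ y ∈ KZ.openOrderedSimplex k,
      ContinuousOn (fun t : ℝ => F (Fin.insertNth p t y)) (Icc (loEdge p y) (hiEdge p y)))
    (hder : ∀ y ∈ KZ.openOrderedSimplex k, ∀ t ∈ Ioo (loEdge p y) (hiEdge p y),
      HasDerivAt (fun s : ℝ => F (Fin.insertNth p s y)) (W (Fin.insertNth p t y)) t)
    (hbase : ∀ y ∈ KZ.openOrderedSimplex k, rb.integrand y =
      F (Fin.insertNth p (hiEdge p y) y) - F (Fin.insertNth p (loEdge p y) y)) :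
    KZ.of R - KZ.of rb ∈ KZ.relations := by
  have hS := KZ.isSemialgebraic_openOrderedSimplex k
  -- relabel the coordinates of `R`
  set R' := R.reindex (reix p) with hR'
  have h1 : KZ.of R - KZ.of R' ∈ KZ.relations := KZ.of_sub_of_reindex_mem_relations R (reix p)
  have hband : ∀ {G : (Fin (k + 1) → ℝ) → ℝ}, IsSemialgebraicFunOn ℚ (sband p) G →
      IsSemialgebraicFunOn ℚ (KZlog.band (KZ.openOrderedSimplex k) (loEdge p) (hiEdge p))
        (fun w => G (fun i => w (reix p i))) := by
    intro G hG
    have h := isSemialgebraicFunOn_comp_perm (reix p) hG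
    convert h using 1
    ext w
    exact (comp_reix_mem_sband_iff p w).symm
  have ha : IsSemialgebraicFunOn ℚ rb.domain (loEdge p) := hbdom ▸ isSemialgebraicFunOn_loEdge hS p
  have hb : IsSemialgebraicFunOn ℚ rb.domain (hiEdge p) := hbdom ▸ isSemialgebraicFunOn_hiEdge hS p
  have hR'dom : R'.domain = {w | (Fin.init w : Fin k → ℝ) ∈ KZ.openOrderedSimplex k ∧
      loEdge p (Fin.init w) < w (Fin.last k) ∧ w (Fin.last k) < hiEdge p (Fin.init w)} := by
    ext w
    rw [hR', KZ.IntegralRep.reindex_domain, mem_setOf_eq, hRdom, mem_setOf_eq]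
    exact comp_reix_mem_openOrderedSimplex_iff p w
  have h2 : KZ.of R' - KZ.of rb ∈ KZ.relations := by
    refine descents_closeBand R' rb (loEdge p) (hiEdge p) (fun w => W (fun i => w (reix p i)))
      (fun w => F (fun i => w (reix p i))) ha hb ?_ ?_ ?_ ?_ ?_ ?_ ?_ ?_ ?_
    · intro x hx
      rw [hbdom] at hx
      exact (loEdge_lt_hiEdge p hx).le
    · rw [hbdom]; exact hband hW
    · rw [hbdom]; exact hband hF
    · intro y hy
      rw [hbdom] at hy
      simpa only [snoc_comp_reix] using hcont y hy
    · intro y hy t ht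
      rw [hbdom] at hy
      simpa only [snoc_comp_reix] using hder y hy t ht
    · intro y hy
      rw [hbdom] at hy
      simpa only [snoc_comp_reix] using hbase y hy
    · intro w hw
      rw [hR'dom, mem_setOf_eq] at hw
      rw [hbdom, KZlog.mem_band]
      exact ⟨hw.1, hw.2.1.le, hw.2.2.le⟩
    · intro w hw
      rw [hR', KZ.IntegralRep.reindex_domain, mem_setOf_eq] at hw
      rw [hR', KZ.IntegralRep.reindex_integrand]
      exact hRW hw
    · -- the collar consists of the two graphs `t = loEdge`, `t = hiEdge` over the simplex
      refine measure_mono_null ?_ (measure_union_null (KZ.volume_graph_eq_zero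
        (isSemialgebraicFunOn_loEdge hS p)) (KZ.volume_graph_eq_zero (isSemialgebraicFunOn_hiEdge hS p)))
      intro w hw
      rw [hbdom, mem_sdiff, KZlog.mem_band, hR'dom] at hw
      obtain ⟨⟨hy, hlo, hhi⟩, hnot⟩ := hw
      rw [mem_union]
      by_cases hca : w (Fin.last k) = loEdge p (Fin.init w)
      · exact Or.inl ⟨hy, hca⟩
      · by_cases hcb : w (Fin.last k) = hiEdge p (Fin.init w)
        · exact Or.inr ⟨hy, hcb⟩
        · exact absurd ⟨hy, lt_of_le_of_ne hlo (Ne.symm hca), lt_of_le_of_ne hhi hcb⟩ hnot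
  have := KZ.relations.add_mem h1 h2
  simpa using this

/-! ## Vertex splitting: summing the move over axes whose derivatives cancel -/

/-- Iterated integrand additivity (rule 1(b)): if the `R i` (`i ∈ s`) have the domain of `r` and
`r.integrand = Σᵢ (R i).integrand` on it, then `[r] − Σᵢ [R i] ∈ KZ.relations`.
(Pattern of `AbelContraction.of_sub_sum_mem_relationsLE`, untruncated.)
[cite: KontsevichZagier2001, §1.2 rule (1)] -/
theorem of_sub_sum_mem_relations {n : ℕ} {ι : Type*} (s : Finset ι) (R : ι → KZ.IntegralRep n) :
    ∀ r : KZ.IntegralRep n, (∀ i ∈ s, (R i).domain = r.domain) →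
      EqOn r.integrand (fun x => ∑ i ∈ s, (R i).integrand x) r.domain →
      KZ.of r - ∑ i ∈ s, KZ.of (R i) ∈ KZ.relations := by
  classical
  induction s using Finset.induction_on with
  | empty =>
    intro r _ h
    simp only [Finset.sum_empty, sub_zero]
    exact KZ.of_mem_relations_of_eqOn_zero r fun x hx => by simpa using h hx
  | insert a s ha ih =>
    intro r hd h
    let r' : KZ.IntegralRep n :=
      { domain := r.domain
        integrand := fun x => ∑ i ∈ s, (R i).integrand x
        isSemialgebraic_domain := r.isSemialgebraic_domain
        isSemialgebraicFunOn_integrand :=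
          KZ.isSemialgebraicFunOn_finset_sum s r.isSemialgebraic_domain fun i hi =>
            hd i (Finset.mem_insert_of_mem hi) ▸ (R i).isSemialgebraicFunOn_integrand
        integrableOn := integrable_finsetSum s fun i hi =>
          hd i (Finset.mem_insert_of_mem hi) ▸ (R i).integrableOn }
    have e1 : KZ.of r - KZ.of (R a) - KZ.of r' ∈ KZ.relations :=
      KZ.integrandAddRel_subset_relations ⟨n, r, R a, r', hd a (Finset.mem_insert_self a s), rfl,
        fun x hx => by
          show r.integrand x = (R a).integrand x + ∑ i ∈ s, (R i).integrand x
          rw [h hx]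
          exact Finset.sum_insert ha, rfl⟩
    have e2 : KZ.of r' - ∑ i ∈ s, KZ.of (R i) ∈ KZ.relations :=
      ih r' (fun i hi => hd i (Finset.mem_insert_of_mem hi)) fun x _ => rfl
    rw [Finset.sum_insert ha]
    have e : KZ.of r - (KZ.of (R a) + ∑ i ∈ s, KZ.of (R i)) =
        (KZ.of r - KZ.of (R a) - KZ.of r') + (KZ.of r' - ∑ i ∈ s, KZ.of (R i)) := by abel
    rw [e]
    exact KZ.relations.add_mem e1 e2

/-- **Representations over a common domain whose integrands sum to zero pointwise sum to a
relation** (rule 1(b) only): if the `R i` (`i ∈ s`) all have domain `σ` and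
`Σᵢ (R i).integrand = 0` on `σ`, then `Σᵢ [R i] ∈ KZ.relations`.
[cite: KontsevichZagier2001, §1.2 rule (1)] -/
theorem sum_of_mem_relations_of_sum_eqOn_zero {n : ℕ} {ι : Type*} (s : Finset ι)
    (R : ι → KZ.IntegralRep n) (σ : Set (Fin n → ℝ)) (hd : ∀ i ∈ s, (R i).domain = σ)
    (h0 : ∀ x ∈ σ, ∑ i ∈ s, (R i).integrand x = 0) :
    ∑ i ∈ s, KZ.of (R i) ∈ KZ.relations := by
  classical
  rcases s.eq_empty_or_nonempty with rfl | ⟨i₀, hi₀⟩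
  · simp [KZ.relations.zero_mem]
  · have hσ : IsSemialgebraic ℚ σ := hd i₀ hi₀ ▸ (R i₀).isSemialgebraic_domain
    let r : KZ.IntegralRep n :=
      { domain := σ
        integrand := fun x => ∑ i ∈ s, (R i).integrand x
        isSemialgebraic_domain := hσ
        isSemialgebraicFunOn_integrand :=
          KZ.isSemialgebraicFunOn_finset_sum s hσ fun i hi => hd i hi ▸ (R i).isSemialgebraicFunOn_integrand
        integrableOn := integrable_finsetSum s fun i hi => hd i hi ▸ (R i).integrableOn }
    have h1 : KZ.of r - ∑ i ∈ s, KZ.of (R i) ∈ KZ.relations :=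
      of_sub_sum_mem_relations s R r (fun i hi => hd i hi) fun x _ => rfl
    have h2 : KZ.of r ∈ KZ.relations := KZ.of_mem_relations_of_eqOn_zero r fun x hx => h0 x hx
    have h3 := KZ.relations.sub_mem h2 h1
    simpa using h3

/-- **Vertex splitting** (faces of a translation-closed form one dimension up).  Let `F` be a
(rational) function on `Δᵏ⁺¹` and `S` a finite family of axes `ax i` with partial derivatives
`W i = ∂_{ax i} F` represented by `R i = [Δᵏ⁺¹, W i]`, such that `Σᵢ W i = 0` on `Δᵏ⁺¹`
(e.g. `F` is invariant under simultaneous translation of the coordinates `ax i`).  If for each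
`i` the axis move `nl_axis_osimplex` applies with base `rb i = [Δᵏ, F|_{t = hiEdge} − F|_{t = loEdge}]`,
then the FACE TERMS alone form a relation: `Σᵢ [rb i] ∈ KZ.relations` — a relation among
representations on `Δᵏ` of the same dimension, the bulk having cancelled by rule 1(b).
[cite: KontsevichZagier2001, §1.2 rules (1), (2), (3)] -/
theorem vertexSplit {ι : Type*} (S : Finset ι) (ax : ι → Fin (k + 1))
    (R : ι → KZ.IntegralRep (k + 1)) (rb : ι → KZ.IntegralRep k)
    (F : (Fin (k + 1) → ℝ) → ℝ) (W : ι → (Fin (k + 1) → ℝ) → ℝ)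
    (hRdom : ∀ i ∈ S, (R i).domain = KZ.openOrderedSimplex (k + 1))
    (hRW : ∀ i ∈ S, EqOn (R i).integrand (W i) (R i).domain)
    (hbdom : ∀ i ∈ S, (rb i).domain = KZ.openOrderedSimplex k)
    (hW : ∀ i ∈ S, IsSemialgebraicFunOn ℚ (sband (ax i)) (W i))
    (hF : ∀ i ∈ S, IsSemialgebraicFunOn ℚ (sband (ax i)) F)
    (hcont : ∀ i ∈ S, ∀ y ∈ KZ.openOrderedSimplex k,
      ContinuousOn (fun t : ℝ => F (Fin.insertNth (ax i) t y)) (Icc (loEdge (ax i) y) (hiEdge (ax i) y)))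
    (hder : ∀ i ∈ S, ∀ y ∈ KZ.openOrderedSimplex k, ∀ t ∈ Ioo (loEdge (ax i) y) (hiEdge (ax i) y),
      HasDerivAt (fun s : ℝ => F (Fin.insertNth (ax i) s y)) (W i (Fin.insertNth (ax i) t y)) t)
    (hbase : ∀ i ∈ S, ∀ y ∈ KZ.openOrderedSimplex k, (rb i).integrand y =
      F (Fin.insertNth (ax i) (hiEdge (ax i) y) y) - F (Fin.insertNth (ax i) (loEdge (ax i) y) y))
    (hsum : ∀ x ∈ KZ.openOrderedSimplex (k + 1), ∑ i ∈ S, W i x = 0) :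
    ∑ i ∈ S, KZ.of (rb i) ∈ KZ.relations := by
  have h1 : ∑ i ∈ S, (KZ.of (R i) - KZ.of (rb i)) ∈ KZ.relations :=
    sum_mem fun i hi => nl_axis_osimplex (ax i) (R i) (rb i) F (W i) (hRdom i hi) (hRW i hi)
      (hbdom i hi) (hW i hi) (hF i hi) (hcont i hi) (hder i hi) (hbase i hi)
  have h2 : ∑ i ∈ S, KZ.of (R i) ∈ KZ.relations := by
    refine sum_of_mem_relations_of_sum_eqOn_zero S R (KZ.openOrderedSimplex (k + 1)) hRdom ?_
    intro x hx
    rw [← hsum x hx]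
    refine Finset.sum_congr rfl fun i hi => hRW i hi ?_
    rw [hRdom i hi]; exact hx
  have e : ∑ i ∈ S, KZ.of (rb i) = ∑ i ∈ S, KZ.of (R i) - ∑ i ∈ S, (KZ.of (R i) - KZ.of (rb i)) := by
    rw [Finset.sum_sub_distrib]; abel
  rw [e]
  exact KZ.relations.sub_mem h2 h1

/-! ## Registered stub (self-contained signature) -/

/-- **Registered sub-goal `stub_translationNL`** of the crux idea `vertex-splitting-unfolded-hyperlog`:
rule 3 along an arbitrary axis of the open ordered simplex, with the fibre edges written out
(`= nl_axis_osimplex`). [cite: KontsevichZagier2001, §1.2 rule (3)] -/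
theorem stub_translationNL : ∀ (k : ℕ) (p : Fin (k + 1)) (R : Literature.NumberTheory.Transcendental.KZ.IntegralRep (k + 1)) (rb : Literature.NumberTheory.Transcendental.KZ.IntegralRep k) (F W : (Fin (k + 1) → ℝ) → ℝ), R.domain = Literature.NumberTheory.Transcendental.KZ.openOrderedSimplex (k + 1) → Set.EqOn R.integrand W R.domain → rb.domain = Literature.NumberTheory.Transcendental.KZ.openOrderedSimplex k → Literature.NumberTheory.Transcendental.IsSemialgebraicFunOn ℚ {z : Fin (k + 1) → ℝ | (fun j => z (p.succAbove j)) ∈ Literature.NumberTheory.Transcendental.KZ.openOrderedSimplex k ∧ (if h : (p : ℕ) < k then z (p.succAbove ⟨p, h⟩) else 0) ≤ z p ∧ z p ≤ (if h : 0 < (p : ℕ) then z (p.succAbove ⟨(p : ℕ) - 1, by omega⟩) else 1)} W → Literature.NumberTheory.Transcendental.IsSemialgebraicFunOn ℚ {z : Fin (k + 1) → ℝ | (fun j => z (p.succAbove j)) ∈ Literature.NumberTheory.Transcendental.KZ.openOrderedSimplex k ∧ (if h : (p : ℕ) < k then z (p.succAbove ⟨p, h⟩) else 0) ≤ z p ∧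 z p ≤ (if h : 0 < (p : ℕ) then z (p.succAbove ⟨(p : ℕ) - 1, by omega⟩) else 1)} F → (∀ y ∈ Literature.NumberTheory.Transcendental.KZ.openOrderedSimplex k, ContinuousOn (fun t : ℝ => F (Fin.insertNth p t y)) (Set.Icc (if h : (p : ℕ) < k then y ⟨p, h⟩ else 0) (if h : 0 < (p : ℕ) then y ⟨(p : ℕ) - 1, by omega⟩ else 1))) → (∀ y ∈ Literature.NumberTheory.Transcendental.KZ.openOrderedSimplex k, ∀ t ∈ Set.Ioo (if h : (p : ℕ) < k then y ⟨p, h⟩ else 0) (if h : 0 < (p : ℕ) then y ⟨(p : ℕ) - 1, by omega⟩ else 1), HasDerivAt (fun s : ℝ => F (Fin.insertNth p s y)) (W (Fin.insertNth p t y)) t) → (∀ y ∈ Literature.NumberTheory.Transcendental.KZ.openOrderedSimplex k, rb.integrand y = F (Fin.insertNth p (if h : 0 < (p : ℕ) then y ⟨(p : ℕ) - 1, by omega⟩ else 1) y) - F (Fin.insertNth p (if h : (p : ℕ) < k then y ⟨p, h⟩ else 0) y)) → Literature.NumberTheory.Transcendental.KZ.of R - Literature.NumberTheory.Transcendental.KZ.of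 rb ∈ Literature.NumberTheory.Transcendental.KZ.relations := by
  intro k p R rb F W hRdom hRW hbdom hW hF hcont hder hbase
  exact nl_axis_osimplex p R rb F W hRdom hRW hbdom hW hF hcont hder hbase

/-- **Registered sub-goal `stub_vertexSplit`** of the crux idea `vertex-splitting-unfolded-hyperlog`: the faces of a
translation-closed form one dimension up sum to a relation (`= vertexSplit`, fully qualified signature).
[cite: KontsevichZagier2001, §1.2 rules (1), (3)] -/
theorem stub_vertexSplit : ∀ (k : ℕ) (ι : Type) (S : Finset ι) (ax : ι → Fin (k + 1)) (R : ι → Literature.NumberTheory.Transcendental.KZ.IntegralRep (k + 1)) (rb : ι → Literature.NumberTheory.Transcendental.KZ.IntegralRep k) (F : (Fin (k + 1) → ℝ) → ℝ) (W : ι → (Fin (k + 1) → ℝ) → ℝ), (∀ i ∈ S, (R i).domain = Literature.NumberTheory.Transcendental.KZ.openOrderedSimplex (k + 1)) → (∀ i ∈ S, Set.EqOn (R i).integrand (W i) (R i).domain) → (∀ i ∈ S, (rb i).domain = Literature.NumberTheory.Transcendental.KZ.openOrderedSimplex k) → (∀ i ∈ S, Literature.NumberTheory.Transcendental.IsSemialgebraicFunOn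 ℚ (Summit.KontsevichZagierPeriods.DihedralNormalForm.VertexSplitting.sband (ax i)) (W i)) → (∀ i ∈ S, Literature.NumberTheory.Transcendental.IsSemialgebraicFunOn ℚ (Summit.KontsevichZagierPeriods.DihedralNormalForm.VertexSplitting.sband (ax i)) F) → (∀ i ∈ S, ∀ y ∈ Literature.NumberTheory.Transcendental.KZ.openOrderedSimplex k, ContinuousOn (fun t : ℝ => F (Fin.insertNth (ax i) t y)) (Set.Icc (Summit.KontsevichZagierPeriods.DihedralNormalForm.VertexSplitting.loEdge (ax i) y) (Summit.KontsevichZagierPeriods.DihedralNormalForm.VertexSplitting.hiEdge (ax i) y))) → (∀ i ∈ S, ∀ y ∈ Literature.NumberTheory.Transcendental.KZ.openOrderedSimplex k, ∀ t ∈ Set.Ioo (Summit.KontsevichZagierPeriods.DihedralNormalForm.VertexSplitting.loEdge (ax i) y) (Summit.KontsevichZagierPeriods.DihedralNormalForm.VertexSplitting.hiEdge (ax i) y), HasDerivAt (fun s : ℝ => F (Fin.insertNth (ax i) s y)) (W i (Fin.insertNth (ax i) t y)) t) → (∀ i ∈ S, ∀ y ∈ Literature.NumberTheory.Transcendental.KZ.openOrderedSimplex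 k, (rb i).integrand y = F (Fin.insertNth (ax i) (Summit.KontsevichZagierPeriods.DihedralNormalForm.VertexSplitting.hiEdge (ax i) y) y) - F (Fin.insertNth (ax i) (Summit.KontsevichZagierPeriods.DihedralNormalForm.VertexSplitting.loEdge (ax i) y) y)) → (∀ x ∈ Literature.NumberTheory.Transcendental.KZ.openOrderedSimplex (k + 1), ∑ i ∈ S, W i x = 0) → ∑ i ∈ S, Literature.NumberTheory.Transcendental.KZ.of (rb i) ∈ Literature.NumberTheory.Transcendental.KZ.relations := by
  intro k ι S ax R rb F W hRdom hRW hbdom hW hF hcont hder hbase hsum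
  exact vertexSplit S ax R rb F W hRdom hRW hbdom hW hF hcont hder hbase hsum

end Summit.KontsevichZagierPeriods.DihedralNormalForm.VertexSplitting
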